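import Summits.NavierStokesRegularity.OSWSelfSimilar.OSWMechanismGlobalBranch08
import HarnessLib

/-!
# OSW self-similar mechanism, companion module (MECHANISM.md §§29–34: THEOREMS M32–M39) — part 09 of 09

1-D model (gCLM/OSW), computer-assisted; not Euler/NS.  Filed under `Summits/NavierStokesRegularity/OSWSelfSimilar/` by a prover-role courier on behalf of the
mechanism seat pub-oswblow-mech (planner-pub-oswblow-mech-g29-0), cell pub-oswblow (host summit NavierStokesRegularity); the gate admits the path but
not role planner.  CONTENT = the staged transcript `pub-oswblow-mech/lean/OSWMechanismGlobalBranch.lean` (sha256 4e5de3f87ec94598…,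
2998 lines), source lines 2940–2998, UNCHANGED except: (i) namespace prefix `OSWSelfSimilar.Mechanism` → `Summit.NavierStokesRegularity.OSWSelfSimilar.Mechanism`;
(ii) the frames open at the cut (section (anonymous) › namespace Summit.NavierStokesRegularity.OSWSelfSimilar.Mechanism.ChenArcShape) are re-opened above the body with their `open` commands replayed, and closed
at the end; (iii) this docstring.  Generated by `pub-oswblow-mech/lean/courier/make_split.py`; the parts must be filed IN ORDER
(each imports its predecessor).  First/last declarations here: `shapeSet_relClosed` … `shape_of_v28` (4 in this part).
AI-written transcript; kernel-checked on the farm as ONE file before splitting (see the kit's CHECKS); to be checked, not trusted.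
-/

noncomputable section
open Complex Set Filter
open scoped Topology
open Literature.Analysis.FluidPDE.OkamotoSakajoWunsch2008
namespace Summit.NavierStokesRegularity.OSWSelfSimilar.Mechanism.ChenArcShape
open Summit.NavierStokesRegularity.OSWSelfSimilar.Mechanism.GlobalBranch Summit.NavierStokesRegularity.OSWSelfSimilar.Mechanism.ChordSlope Summit.NavierStokesRegularity.OSWSelfSimilar.Mechanism.SourceDefect
open Summit.NavierStokesRegularity.OSWSelfSimilar.Mechanism.FirstCritFloor Summit.NavierStokesRegularity.OSWSelfSimilar.Mechanism.EffectiveFloor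
open Set

/-- COROLLARY 34.5 (b), first clause, KERNEL-CHECKED from the typed COROLLARY 34.5 (a) and (22.16): `𝒯` is relatively
closed in `(0,∞)` (a positive limit of parameters in `𝒯` is in `𝒯`). -/
theorem shapeSet_relClosed {aσ : ℝ → ℝ} {cσ : ℝ → ℤ → ℂ} (hC : DefectCharacterisesS aσ cσ)
    (hD : DefectContinuous aσ cσ) : ∀ s : ℝ, 0 < s → s ∈ closure (shapeSet cσ) → s ∈ shapeSet cσ := by
  intro s hs hcl
  refine ⟨hs, ?_⟩
  rw [hC s hs]
  intro x hx
  by_contra hpos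
  push Not at hpos
  obtain ⟨δ, hδ, hδ'⟩ := hD s hs (chiR (aσ s) (cσ s) x) hpos
  obtain ⟨σ, hσT, hdist⟩ := Metric.mem_closure_iff.1 hcl δ hδ
  have hσχ : chiR (aσ σ) (cσ σ) x ≤ 0 := ((hC σ hσT.1).1 hσT.2) x hx
  have hlt := hδ' σ hσT.1 (by rw [← Real.dist_eq, dist_comm]; exact hdist) x hx
  rw [abs_lt] at hlt
  linarith [hlt.1]

/-- **COROLLARY 34.5 (c), the EXIT-PARAMETER DICHOTOMY, KERNEL-CHECKED** from the typed (22.16), COROLLARY 34.5 (a) and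
THEOREM M39 (a) via `exit_parameter_dichotomy`: EITHER `f(σ) ∈ 𝒮` along the WHOLE branch (then COROLLARY 32.6 (b):
the ladder or `(E2♯)`), OR there is an exit parameter `σ_𝒮 > 0` with `f(σ) ∈ 𝒮` for `0 < σ ≤ σ_𝒮` and `f(σ) ∉ 𝒮` for
parameters above and arbitrarily close to `σ_𝒮` (and then, by COROLLARY 34.5 (b) — pen-and-paper — `f(σ_𝒮)` has an
interior double zero of `u′`). -/
theorem exit_dichotomy {aσ : ℝ → ℝ} {cσ : ℝ → ℤ → ℂ} (hC : DefectCharacterisesS aσ cσ) (hD : DefectContinuous aσ cσ)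
    (hA : ArcStrictlyInS aσ cσ) :
    (∀ σ : ℝ, 0 < σ → InS (cσ σ)) ∨
      ∃ σS : ℝ, 0 < σS ∧ (∀ σ : ℝ, 0 < σ → σ ≤ σS → InS (cσ σ)) ∧
        ∀ δ : ℝ, 0 < δ → ∃ σ : ℝ, σS < σ ∧ σ < σS + δ ∧ ¬ InS (cσ σ) := by
  obtain ⟨εS, hε, hstart⟩ := start_in_S hA
  have h0 : Set.Ioc 0 εS ⊆ shapeSet cσ := fun σ hσ => ⟨hσ.1, hstart σ hσ.1 hσ.2⟩
  rcases exit_parameter_dichotomy (shapeSet cσ) (shapeSet_relClosed hC hD) εS hε h0 with h | ⟨σS, hσS, hIoc, hout⟩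
  · left
    exact fun σ hσ => (h hσ).2
  · right
    refine ⟨σS, hσS, fun σ hσ hσ' => (hIoc ⟨hσ, hσ'⟩).2, fun δ hδ => ?_⟩
    obtain ⟨σ, h1, h2, h3⟩ := hout δ hδ
    exact ⟨σ, h1, h2, fun hin => h3 ⟨by linarith, hin⟩⟩

/-- **The v28 bundle of this module's §34 block:** the v27 bundle ∧ the §34 statement. -/
def ChenArcShapeBundle (NegP : ℝ → (ℤ → ℂ) → Prop) : Prop :=
  EffectiveFloorBundle NegP ∧ ChenArcShapeStatement NegP

/-- **v28 headline reduction (kernel-checked):** along the branch family of the v28 bundle, the branch starts in `𝒮`,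
the chord slope tends to `1` from above at the De Gregorio end, and the exit-parameter dichotomy holds. -/
theorem shape_of_v28 {NegP : ℝ → (ℤ → ℂ) → Prop} (h28 : ChenArcShapeBundle NegP) :
    ∀ β : NNReal, 0 < β → β < 1 → ∃ (aσ : ℝ → ℝ) (cσ : ℝ → ℤ → ℂ), BranchFamily NegP β aσ cσ ∧
      (∃ εS : ℝ, 0 < εS ∧ ∀ σ : ℝ, 0 < σ → σ ≤ εS → InS (cσ σ)) ∧
      Tendsto (fun σ => (1 - aσ σ) * (-deriv (fR (cσ σ)) 0)) (𝓝[>] 0) (𝓝 1) ∧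
      (∀ᶠ σ in 𝓝[>] 0, 1 < (1 - aσ σ) * (-deriv (fR (cσ σ)) 0)) ∧
      ((∀ σ : ℝ, 0 < σ → InS (cσ σ)) ∨
        ∃ σS : ℝ, 0 < σS ∧ (∀ σ : ℝ, 0 < σ → σ ≤ σS → InS (cσ σ)) ∧
          ∀ δ : ℝ, 0 < δ → ∃ σ : ℝ, σS < σ ∧ σ < σS + δ ∧ ¬ InS (cσ σ)) := by
  intro β hβ0 hβ1
  obtain ⟨aσ, cσ, hF, hC, hD, hA, hE⟩ := h28.2 β hβ0 hβ1
  exact ⟨aσ, cσ, hF, start_in_S hA, chordSlope_tendsto_one hE, chordSlope_gt_one_eventually hE,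
    exit_dichotomy hC hD hA⟩

end Summit.NavierStokesRegularity.OSWSelfSimilar.Mechanism.ChenArcShape

end
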